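import Mathlib.MeasureTheory.Measure.Haar.Unique
import Literature.MathematicalPhysics.StatisticalMechanics.FccWulffBodyVolume
import Literature.MathematicalPhysics.StatisticalMechanics.WulffCrystalEmergence
import Literature.Analysis.Convexity.AnisotropicPerimeterSelf
import HarnessLib

/-!
# The fcc Wulff body: the four descriptions coincide

Topic `Literature/MathematicalPhysics/StatisticalMechanics`; companion of `FccSurfaceTension.lean`
(`phiFcc = h_W`, the Wulff body `fccWulffBody = conv{perm(0, ±1, ±2)}`), of
`FccWulffBodyVolume.lean` (the cube–octahedron intersection lies in the support body and has
volume `≥ 32`) and of `WulffCrystalEmergence.lean` (`wulffSet ϕ = {ζ | ∀ ‖ν‖ = 1, ⟪ζ, ν⟫ ≤ ϕ ν}`,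
Cicalese–Kreutz–Leonardi's (22)).  The tree now carries four spellings of the fcc Wulff body in
the halved normalisation of [CicaleseKreutzLeonardi2023, Prop. 2.4 (24)] ("`W_{ϕ_FCC}` is the
intersection of a cube with an octahedron … a truncated octahedron"):

* the convex hull `fccWulffBody = conv{perm(0, ±1, ±2)}`;
* the support body `{y | ∀ ν, ⟪y, ν⟫ ≤ φ_fcc(ν)}` (the form of the venture's `PolyWulff.wulffOf`);
* the printed Wulff set over unit normals `wulffSet phiFcc`;
* the half-space (cube ∩ octahedron) form `{y | ∀ i, |y i| ≤ 2} ∩ {y | Σ_i |y i| ≤ 3}`.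

This file proves they are all EQUAL (`fccWulffBody_eq_setOf_forall_inner`,
`fccWulffBody_eq_truncOct`, and the membership forms `mem_fccWulffBody_iff…`,
`forall_inner_le_phiFcc_iff`): "support body ⊆ cube ∩ octahedron" by testing the normals `±e_i` and
the sign vector of `y`; "cube ∩ octahedron ⊆ support body" is `inner_le_phiFcc_of_mem_truncOct`
(`FccWulffBodyVolume.lean`); "support body ⊆ hull" is the tree's Hahn–Banach step
`wulffSet_phiFcc_eq_fccWulffBody` (`WulffCrystalEmergence.lean`, unit normals) plus homogeneity.
Hence the hull inherits the volume bound `32 ≤ vol(fccWulffBody)` of `FccWulffBodyVolume.lean`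
(`le_volume_fccWulffBody`), and §"The volume is exactly 32" supplies the matching UPPER bound
(the truncated octahedron and the six tips `{±ζ_i > 2}` are disjoint inside the `ℓ¹`-ball of
radius `3` (volume `36`), each tip containing a translate of a half unit `ℓ¹`-ball (volume
`≥ 2/3`, the coordinate hyperplane being null)), so `vol(fccWulffBody) = 32` — the printed
`|W_{ϕ_FCC}| = 2⁸` of [CicaleseKreutzLeonardi2023, proof of Prop. 2.4, Step 3] in the halved
normalisation (`2⁸/2³`).  §"The anisotropic perimeter of the fcc Wulff body itself" then reads
off `P_W(W) = 3 · |W| = 96` (all three cubic-frame spellings, `ℝ≥0∞` and real forms) from the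
general identity `anisotropicPerimeter K K = n · vol K` of
`Literature/Analysis/Convexity/AnisotropicPerimeterSelf.lean` (Maggi's (20.11) `Φ(W_Φ) = n|W_Φ|`):
the one-grain equality case `Per_{W_A}(W_A) = 3|W_A|^{1/3}(|W_A|)^{2/3} = 96` of the Wulff bound
used by the venture `Summits/Ventures/Crystal3D` (any orientation `A`: apply
`anisotropicPerimeter_self` to the isometric image, which is again compact convex `∋ 0` of volume
`32`).  No definition and no named fact is introduced.

## References
* M. Cicalese, L. Kreutz, G. P. Leonardi, *Emergence of Wulff-crystals from atomistic systems on
  the FCC and HCP lattices*, CMP 402 (2023), Prop. 2.4 (24) and its proof, Steps 2–3.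
  [`CicaleseKreutzLeonardi2023`]
* F. Maggi, *Sets of Finite Perimeter and Geometric Variational Problems* (CUP 2012), §20.2,
  (20.8) and Prop. 20.10 (Wulff shapes as intersections of half-spaces / support functions).
  [`Maggi2012`]
-/

noncomputable section

namespace Literature.MathematicalPhysics.StatisticalMechanics

open _root_.MeasureTheory Set Finset
open scoped RealInnerProductSpace ENNReal
open Literature.Geometry.DiscreteGeometry (intVec intVec_apply)

/-! ### The support body lies in the cube–octahedron intersection -/

/-- `φ_fcc` of a coordinate vector: `φ_fcc(a e_i) = 2|a|` (a `{100}` normal).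
[cite: CicaleseKreutzLeonardi2023, Proposition 2.4 (23)] -/
theorem phiFcc_single (i : Fin 3) (a : ℝ) : phiFcc (EuclideanSpace.single i a) = 2 * |a| := by
  rw [phiFcc_eq_sum_max]
  fin_cases i <;> simp <;> ring

/-- A point of the support body has all coordinates in `[-2, 2]` (test the normals `±e_i`:
`±y_i = ⟪y, ±e_i⟫ ≤ φ_fcc(±e_i) = 2`). [cite: CicaleseKreutzLeonardi2023, Proposition 2.4 (24)] -/
theorem abs_apply_le_two_of_forall_inner_le_phiFcc {y : EuclideanSpace ℝ (Fin 3)}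
    (h : ∀ ν : EuclideanSpace ℝ (Fin 3), ⟪y, ν⟫ ≤ phiFcc ν) (i : Fin 3) : |y i| ≤ 2 := by
  have h1 := h (EuclideanSpace.single i (1 : ℝ))
  have h2 := h (EuclideanSpace.single i (-1 : ℝ))
  rw [EuclideanSpace.inner_single_right, phiFcc_single] at h1 h2
  simp only [RCLike.conj_to_real, one_mul, abs_one, mul_one, neg_mul, abs_neg] at h1 h2
  rw [abs_le]
  constructor <;> linarith

/-- A point of the support body has `ℓ¹`-norm at most `3` (test the sign vector `(±1, ±1, ±1)` of `y`,
a `{111}` normal with `φ_fcc = 3`). [cite: CicaleseKreutzLeonardi2023, Proposition 2.4 (24)] -/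
theorem sum_abs_apply_le_three_of_forall_inner_le_phiFcc {y : EuclideanSpace ℝ (Fin 3)}
    (h : ∀ ν : EuclideanSpace ℝ (Fin 3), ⟪y, ν⟫ ≤ phiFcc ν) : ∑ i, |y i| ≤ 3 := by
  -- the sign vector of `y`
  set s : EuclideanSpace ℝ (Fin 3) := WithLp.toLp 2 fun j => if 0 ≤ y j then (1 : ℝ) else -1
    with hs
  have hsj : ∀ j, s j = if 0 ≤ y j then (1 : ℝ) else -1 := fun j => rfl
  have habs : ∀ j, |s j| = 1 := fun j => by
    rw [hsj]; split_ifs <;> simp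
  have hys : ∀ j, y j * s j = |y j| := fun j => by
    rw [hsj]
    split_ifs with hj
    · rw [mul_one, abs_of_nonneg hj]
    · rw [mul_neg, mul_one, abs_of_neg (lt_of_not_ge hj)]
  have hinner : ⟪y, s⟫ = ∑ j, |y j| := by
    have : ⟪y, s⟫ = y 0 * s 0 + y 1 * s 1 + y 2 * s 2 := by
      simp [EuclideanSpace.inner_eq_star_dotProduct, dotProduct, Fin.sum_univ_three, mul_comm]
    rw [this, Fin.sum_univ_three, hys, hys, hys]
  have hphi : phiFcc s = 3 := by
    rw [phiFcc_eq_sum_max, habs, habs, habs]; norm_num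
  have := h s
  rwa [hinner, hphi] at this

/-- **Support body = cube ∩ octahedron**: `(∀ ν, ⟪y, ν⟫ ≤ φ_fcc ν) ↔ (∀ i, |y_i| ≤ 2) ∧ Σ|y_i| ≤ 3`
("`W_{ϕ_FCC}` is the intersection of a cube with an octahedron", halved normalisation; the
reverse implication is `inner_le_phiFcc_of_mem_truncOct` of `FccWulffBodyVolume.lean`).
[cite: CicaleseKreutzLeonardi2023, Proposition 2.4 (24), proof Step 3] -/
theorem forall_inner_le_phiFcc_iff (y : EuclideanSpace ℝ (Fin 3)) :
    (∀ ν : EuclideanSpace ℝ (Fin 3), ⟪y, ν⟫ ≤ phiFcc ν) ↔ (∀ i, |y i| ≤ 2) ∧ ∑ i, |y i| ≤ 3 :=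
  ⟨fun h => ⟨abs_apply_le_two_of_forall_inner_le_phiFcc h,
    sum_abs_apply_le_three_of_forall_inner_le_phiFcc h⟩,
    fun h ν => inner_le_phiFcc_of_mem_truncOct h.1 h.2 ν⟩

/-! ### The support body is the convex hull -/

/-- **Support body ⊆ hull**: a point pairing against every `ν` to at most `φ_fcc(ν) = h_W(ν)` lies
in `W = conv{perm(0, ±1, ±2)}` — it lies in the printed Wulff set `wulffSet phiFcc` (unit normals),
which is the hull by the tree's separation argument `wulffSet_phiFcc_eq_fccWulffBody`.
(A compact convex set is the intersection of its supporting half-spaces.)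
[cite: Maggi2012, §20.2 (20.8) and Proposition 20.10] -/
theorem mem_fccWulffBody_of_forall_inner_le_phiFcc {y : EuclideanSpace ℝ (Fin 3)}
    (h : ∀ ν : EuclideanSpace ℝ (Fin 3), ⟪y, ν⟫ ≤ phiFcc ν) : y ∈ fccWulffBody := by
  rw [← wulffSet_phiFcc_eq_fccWulffBody]
  exact fun ν _ => h ν

/-- **Hull = support body** (membership form): `y ∈ conv{perm(0,±1,±2)} ↔ ∀ ν, ⟪y, ν⟫ ≤ φ_fcc(ν)` —
`φ_fcc` is the support function `h_W` and `W` is recovered from it.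
[cite: CicaleseKreutzLeonardi2023, Proposition 2.4 (24)] -/
theorem mem_fccWulffBody_iff_forall_inner_le_phiFcc (y : EuclideanSpace ℝ (Fin 3)) :
    y ∈ fccWulffBody ↔ ∀ ν : EuclideanSpace ℝ (Fin 3), ⟪y, ν⟫ ≤ phiFcc ν :=
  ⟨fun hy ν => inner_le_phiFcc_of_mem_fccWulffBody ν hy, mem_fccWulffBody_of_forall_inner_le_phiFcc⟩

/-- **Hull = support body** (set form). [cite: CicaleseKreutzLeonardi2023, Proposition 2.4 (24)] -/
theorem fccWulffBody_eq_setOf_forall_inner :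
    fccWulffBody = {y : EuclideanSpace ℝ (Fin 3) | ∀ ν : EuclideanSpace ℝ (Fin 3), ⟪y, ν⟫ ≤ phiFcc ν} :=
  Set.ext mem_fccWulffBody_iff_forall_inner_le_phiFcc

/-- **Hull = cube ∩ octahedron** (membership form): `y ∈ conv{perm(0,±1,±2)} ↔ ‖y‖_∞ ≤ 2 ∧ ‖y‖₁ ≤ 3`.
[cite: CicaleseKreutzLeonardi2023, Proposition 2.4 (24), proof Step 3] -/
theorem mem_fccWulffBody_iff (y : EuclideanSpace ℝ (Fin 3)) :
    y ∈ fccWulffBody ↔ (∀ i, |y i| ≤ 2) ∧ ∑ i, |y i| ≤ 3 :=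
  (mem_fccWulffBody_iff_forall_inner_le_phiFcc y).trans (forall_inner_le_phiFcc_iff y)

/-- **Hull = cube ∩ octahedron** (set form): `conv{perm(0,±1,±2)} = {‖y‖_∞ ≤ 2} ∩ {‖y‖₁ ≤ 3}`.
[cite: CicaleseKreutzLeonardi2023, Proposition 2.4 (24), proof Step 3] -/
theorem fccWulffBody_eq_truncOct :
    fccWulffBody = {y : EuclideanSpace ℝ (Fin 3) | (∀ i, |y i| ≤ 2) ∧ ∑ i, |y i| ≤ 3} :=
  Set.ext mem_fccWulffBody_iff

/-- Testing unit normals only (the printed Wulff set (22), `wulffSet`) or all `ν` gives the same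
body: `ζ ∈ W_{φ_fcc} ↔ ∀ ν, ⟪ζ, ν⟫ ≤ φ_fcc(ν)` (positive homogeneity of `φ_fcc`; via the tree's
`wulffSet_phiFcc_eq_fccWulffBody`). [cite: CicaleseKreutzLeonardi2023, (22) p. 8 and Proposition 2.4 (24)] -/
theorem mem_wulffSet_phiFcc_iff_forall_inner (ζ : EuclideanSpace ℝ (Fin 3)) :
    ζ ∈ wulffSet phiFcc ↔ ∀ ν : EuclideanSpace ℝ (Fin 3), ⟪ζ, ν⟫ ≤ phiFcc ν := by
  rw [wulffSet_phiFcc_eq_fccWulffBody, mem_fccWulffBody_iff_forall_inner_le_phiFcc]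

/-- The printed Wulff set (22) of `φ_fcc` in half-space form: `W_{φ_fcc} = {‖ζ‖_∞ ≤ 2} ∩ {‖ζ‖₁ ≤ 3}`.
[cite: CicaleseKreutzLeonardi2023, Proposition 2.4 (24), proof Step 3] -/
theorem wulffSet_phiFcc_eq_truncOct :
    wulffSet phiFcc = {y : EuclideanSpace ℝ (Fin 3) | (∀ i, |y i| ≤ 2) ∧ ∑ i, |y i| ≤ 3} := by
  rw [wulffSet_phiFcc_eq_fccWulffBody, fccWulffBody_eq_truncOct]

/-! ### Volume of the hull -/

/-- **`32 ≤ vol(conv{perm(0,±1,±2)})`** — the volume bound of `FccWulffBodyVolume.lean`, transported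
to the hull by `fccWulffBody_eq_truncOct` (the truncated octahedron of volume `32`, `|W_{ϕ_FCC}| = 2⁸`
in the printed normalisation, halved: `2⁸/2³ = 32`).
[cite: CicaleseKreutzLeonardi2023, Proposition 2.4 (25) and proof Step 3] -/
theorem le_volume_fccWulffBody : ENNReal.ofReal 32 ≤ volume fccWulffBody := by
  rw [fccWulffBody_eq_truncOct]
  exact le_volume_truncOct

/-! ### The volume is exactly `32` -/

section VolumeEq

open _root_.MeasureTheory.Measure

/-- Volume of the `ℓ¹`-ball of radius `r` in `Fin 3 → ℝ`: `(4/3)·r³` (Mathlib's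
`volume_sum_rpow_le` at `p = 1`). [folklore] -/
private theorem volume_l1Ball_three (r : ℝ) :
    volume {f : Fin 3 → ℝ | ∑ i, |f i| ≤ r} = ENNReal.ofReal r ^ 3 * ENNReal.ofReal (4 / 3) := by
  have h := MeasureTheory.volume_sum_rpow_le (ι := Fin 3) (p := 1) le_rfl r
  simp only [Real.rpow_one, div_one, Fintype.card_fin] at h
  rw [show (1 : ℝ) + 1 = 2 by norm_num, Real.Gamma_two, Real.Gamma_nat_eq_factorial 3] at h
  rw [h]
  norm_num [Nat.factorial]

/-- The `ℓ¹`-sum of a point of `Fin 3 → ℝ` is measurable. [folklore] -/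
private theorem measurable_sum_abs : Measurable fun w : Fin 3 → ℝ => ∑ j, |w j| :=
  Finset.measurable_sum _ fun j _ => (continuous_apply j).abs.measurable

/-- The half ball `{0 < s·w_i, Σ|w_j| ≤ 1}` is measurable. [folklore] -/
private theorem measurableSet_halfBall (i : Fin 3) (s : ℝ) :
    MeasurableSet {w : Fin 3 → ℝ | 0 < s * w i ∧ ∑ j, |w j| ≤ 1} := by
  rw [Set.setOf_and]
  exact (measurableSet_lt measurable_const ((measurable_pi_apply i).const_mul s)).inter
    (measurableSet_le measurable_sum_abs measurable_const)

/-- The half unit `ℓ¹`-ball `{Σ|w_j| ≤ 1, 0 < s·w_i}` (`s = ±1`) has volume `≥ 2/3`: the ball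
(volume `4/3`) is covered by it, its mirror image under `w ↦ −w` (same volume) and the null
hyperplane `{w_i = 0}`. [folklore] -/
private theorem le_volume_halfBall (i : Fin 3) {s : ℝ} (hs : s = 1 ∨ s = -1) :
    ENNReal.ofReal (2 / 3) ≤ volume {w : Fin 3 → ℝ | 0 < s * w i ∧ ∑ j, |w j| ≤ 1} := by
  set H : ℝ → Set (Fin 3 → ℝ) := fun s => {w | 0 < s * w i ∧ ∑ j, |w j| ≤ 1} with hH
  have hneg : H (-s) = Neg.neg ⁻¹' H s := by
    ext w; simp [hH, Pi.neg_apply, abs_neg]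
  have hvol : volume (H (-s)) = volume (H s) := by
    rw [hneg, measure_preimage_neg]
  -- the coordinate hyperplane is null
  set Z : Submodule ℝ (Fin 3 → ℝ) := LinearMap.ker (LinearMap.proj i) with hZ
  have hZne : Z ≠ ⊤ := by
    intro htop
    have hmem : (Pi.single i (1 : ℝ) : Fin 3 → ℝ) ∈ Z := htop ▸ Submodule.mem_top
    rw [hZ, LinearMap.mem_ker, LinearMap.proj_apply, Pi.single_eq_same] at hmem
    exact one_ne_zero hmem
  have hZnull : volume (Z : Set (Fin 3 → ℝ)) = 0 := addHaar_submodule volume Z hZne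
  -- cover the ball
  have hcover : {f : Fin 3 → ℝ | ∑ j, |f j| ≤ 1} ⊆ (H s ∪ H (-s)) ∪ (Z : Set (Fin 3 → ℝ)) := by
    intro w hw
    rcases lt_trichotomy 0 (s * w i) with hlt | heq | hgt
    · exact Or.inl (Or.inl ⟨hlt, hw⟩)
    · refine Or.inr ?_
      have hs0 : s ≠ 0 := by rcases hs with rfl | rfl <;> norm_num
      have hwi : w i = 0 := by
        rcases mul_eq_zero.1 heq.symm with h | h
        · exact absurd h hs0
        · exact h
      change w ∈ LinearMap.ker (LinearMap.proj i)
      rw [LinearMap.mem_ker, LinearMap.proj_apply, hwi]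
    · exact Or.inl (Or.inr ⟨by rw [neg_mul]; linarith, hw⟩)
  have key : ENNReal.ofReal 1 ^ 3 * ENNReal.ofReal (4 / 3) ≤ volume (H s) + volume (H s) := by
    calc ENNReal.ofReal 1 ^ 3 * ENNReal.ofReal (4 / 3) = volume {f : Fin 3 → ℝ | ∑ j, |f j| ≤ 1} :=
          (volume_l1Ball_three 1).symm
      _ ≤ volume ((H s ∪ H (-s)) ∪ (Z : Set (Fin 3 → ℝ))) := measure_mono hcover
      _ ≤ volume (H s ∪ H (-s)) + volume (Z : Set (Fin 3 → ℝ)) := measure_union_le _ _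
      _ ≤ (volume (H s) + volume (H (-s))) + 0 := by
          rw [hZnull]; exact add_le_add (measure_union_le _ _) le_rfl
      _ = volume (H s) + volume (H s) := by rw [hvol, add_zero]
  rw [ENNReal.ofReal_one, one_pow, one_mul, show (4 : ℝ) / 3 = 2 / 3 + 2 / 3 by norm_num,
    ENNReal.ofReal_add (by norm_num) (by norm_num)] at key
  by_contra h
  push Not at h
  exact absurd key (not_le.2 (ENNReal.add_lt_add h h))

/-- A tip `{2 < s·f_i, Σ|f_j| ≤ 3}` (`s = ±1`) contains the translate by `2s·e_i` of the half unit
ball, hence has volume `≥ 2/3`. [folklore] -/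
private theorem le_volume_tip (i : Fin 3) {s : ℝ} (hs : s = 1 ∨ s = -1) :
    ENNReal.ofReal (2 / 3) ≤ volume {f : Fin 3 → ℝ | 2 < s * f i ∧ ∑ j, |f j| ≤ 3} := by
  have hs2 : s * s = 1 := by rcases hs with rfl | rfl <;> norm_num
  set c : Fin 3 → ℝ := Function.update 0 i (2 * s) with hc
  have hci : c i = 2 * s := by simp [hc]
  have hcj : ∀ j, j ≠ i → c j = 0 := fun j hj => by simp [hc, hj]
  have hsub : {w : Fin 3 → ℝ | 0 < s * w i ∧ ∑ j, |w j| ≤ 1} ⊆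
      (fun w => w + c) ⁻¹' {f : Fin 3 → ℝ | 2 < s * f i ∧ ∑ j, |f j| ≤ 3} := by
    intro w hw
    obtain ⟨hw1, hw2⟩ := hw
    simp only [Set.mem_preimage, Set.mem_setOf_eq, Pi.add_apply, hci]
    refine ⟨by nlinarith, ?_⟩
    have hterm : |w i + 2 * s| = |w i| + 2 := by
      rcases hs with rfl | rfl
      · have : 0 < w i := by linarith
        rw [abs_of_pos (by linarith), abs_of_pos this]; ring
      · have : w i < 0 := by linarith
        rw [abs_of_neg (by linarith), abs_of_neg this]; ring
    have hsplit : ∑ j, |w j + c j| = (∑ j, |w j|) + 2 := by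
      rw [← Finset.sum_erase_add _ _ (Finset.mem_univ i),
        ← Finset.sum_erase_add (Finset.univ) (fun j => |w j|) (Finset.mem_univ i), hci, hterm]
      have : ∑ j ∈ Finset.univ.erase i, |w j + c j| = ∑ j ∈ Finset.univ.erase i, |w j| :=
        Finset.sum_congr rfl fun j hj => by rw [hcj j (Finset.ne_of_mem_erase hj), add_zero]
      rw [this]; ring
    linarith
  calc ENNReal.ofReal (2 / 3) ≤ volume {w : Fin 3 → ℝ | 0 < s * w i ∧ ∑ j, |w j| ≤ 1} :=
        le_volume_halfBall i hs
    _ ≤ volume ((fun w => w + c) ⁻¹' {f : Fin 3 → ℝ | 2 < s * f i ∧ ∑ j, |f j| ≤ 3}) :=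
        measure_mono hsub
    _ = volume {f : Fin 3 → ℝ | 2 < s * f i ∧ ∑ j, |f j| ≤ 3} := measure_preimage_add_right _ _ _

/-- The tips are measurable. [folklore] -/
private theorem measurableSet_tip (i : Fin 3) (s : ℝ) :
    MeasurableSet {f : Fin 3 → ℝ | 2 < s * f i ∧ ∑ j, |f j| ≤ 3} := by
  rw [Set.setOf_and]
  exact (measurableSet_lt measurable_const ((measurable_pi_apply i).const_mul s)).inter
    (measurableSet_le measurable_sum_abs measurable_const)

/-- Two coordinates of absolute value `> 2` force `Σ|f_j| > 3`. [folklore] -/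
private theorem sum_abs_gt_of_two {f : Fin 3 → ℝ} {i j : Fin 3} (hij : i ≠ j) (hi : 2 < |f i|)
    (hj : 2 < |f j|) : 3 < ∑ k, |f k| := by
  have h2 : ∑ k ∈ ({i, j} : Finset (Fin 3)), |f k| ≤ ∑ k, |f k| :=
    Finset.sum_le_sum_of_subset_of_nonneg (Finset.subset_univ _) fun k _ _ => abs_nonneg _
  rw [Finset.sum_pair hij] at h2
  linarith

/-- Volume of the truncated octahedron in coordinates `Fin 3 → ℝ`: `vol {Σ|f_i| ≤ 3, |f_i| ≤ 2} ≤ 32`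
(the body and the six pairwise disjoint tips lie in the `ℓ¹`-ball of volume `36`; the tips have
volume `≥ 2/3` each). [folklore] -/
private theorem volume_truncOct_pi_le :
    volume {f : Fin 3 → ℝ | (∀ i, |f i| ≤ 2) ∧ ∑ i, |f i| ≤ 3} ≤ ENNReal.ofReal 32 := by
  set O : Set (Fin 3 → ℝ) := {f | ∑ i, |f i| ≤ 3} with hO
  set T : Set (Fin 3 → ℝ) := {f | (∀ i, |f i| ≤ 2) ∧ ∑ i, |f i| ≤ 3} with hT
  set tip : Fin 3 → ℝ → Set (Fin 3 → ℝ) := fun i s => {f | 2 < s * f i ∧ ∑ j, |f j| ≤ 3}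
    with htip
  set U : Set (Fin 3 → ℝ) := ⋃ i, (tip i 1 ∪ tip i (-1)) with hU
  -- a point of a tip has a coordinate of absolute value `> 2`
  have habs : ∀ i s f, (s = (1 : ℝ) ∨ s = -1) → f ∈ tip i s → 2 < |f i| := by
    rintro i s f (rfl | rfl) ⟨h, -⟩
    · rw [one_mul] at h; exact h.trans_le (le_abs_self _)
    · rw [neg_mul, one_mul] at h; exact h.trans_le (neg_le_abs _)
  have hmT : MeasurableSet T := by
    rw [hT, Set.setOf_and]
    refine MeasurableSet.inter ?_ (measurableSet_le measurable_sum_abs measurable_const)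
    have : {f : Fin 3 → ℝ | ∀ i, |f i| ≤ 2} = ⋂ i, {f | |f i| ≤ 2} := by ext f; simp
    rw [this]
    exact MeasurableSet.iInter fun i =>
      measurableSet_le (measurable_pi_apply i).abs measurable_const
  have hmpair : ∀ i, MeasurableSet (tip i 1 ∪ tip i (-1)) := fun i =>
    (measurableSet_tip i 1).union (measurableSet_tip i (-1))
  have hmU : MeasurableSet U := MeasurableSet.iUnion hmpair
  -- disjointness
  have hdisj_pm : ∀ i, Disjoint (tip i 1) (tip i (-1)) := fun i => by
    rw [Set.disjoint_left]
    rintro f ⟨h1, -⟩ ⟨h2, -⟩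
    rw [one_mul] at h1; rw [neg_mul, one_mul] at h2; linarith
  have hdisj_U : Pairwise (Function.onFun Disjoint fun i => tip i 1 ∪ tip i (-1)) := by
    intro i j hij
    rw [Function.onFun, Set.disjoint_left]
    intro f hfi hfj
    have hi : 2 < |f i| := by
      rcases hfi with h | h
      · exact habs i 1 f (Or.inl rfl) h
      · exact habs i (-1) f (Or.inr rfl) h
    have hj : 2 < |f j| := by
      rcases hfj with h | h
      · exact habs j 1 f (Or.inl rfl) h
      · exact habs j (-1) f (Or.inr rfl) h
    have hsum : ∑ k, |f k| ≤ 3 := by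
      rcases hfi with ⟨-, h⟩ | ⟨-, h⟩ <;> exact h
    exact absurd hsum (not_le.2 (sum_abs_gt_of_two hij hi hj))
  have hdisj_TU : Disjoint T U := by
    rw [Set.disjoint_left]
    rintro f ⟨hf2, -⟩ hfU
    obtain ⟨i, hi⟩ := Set.mem_iUnion.1 hfU
    have : 2 < |f i| := by
      rcases hi with h | h
      · exact habs i 1 f (Or.inl rfl) h
      · exact habs i (-1) f (Or.inr rfl) h
    exact absurd (hf2 i) (not_le.2 this)
  -- everything lies in the `ℓ¹`-ball of radius `3`
  have hsubO : T ∪ U ⊆ O := by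
    rintro f (⟨-, hf⟩ | hfU)
    · exact hf
    · obtain ⟨i, hi⟩ := Set.mem_iUnion.1 hfU
      rcases hi with ⟨-, h⟩ | ⟨-, h⟩ <;> exact h
  have hO36 : volume O = ENNReal.ofReal 36 := by
    rw [hO, volume_l1Ball_three 3, ← ENNReal.ofReal_pow (by norm_num),
      ← ENNReal.ofReal_mul (by norm_num)]
    norm_num
  -- the tips carry volume `≥ 4`
  have hU4 : ENNReal.ofReal 4 ≤ volume U := by
    rw [hU, measure_iUnion hdisj_U hmpair, tsum_fintype]
    have h1 : ∀ i, ENNReal.ofReal (2 / 3) + ENNReal.ofReal (2 / 3) ≤ volume (tip i 1 ∪ tip i (-1)) :=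
      fun i => by
        rw [measure_union (hdisj_pm i) (measurableSet_tip i (-1))]
        exact add_le_add (le_volume_tip i (Or.inl rfl)) (le_volume_tip i (Or.inr rfl))
    calc ENNReal.ofReal 4 = ∑ _i : Fin 3, (ENNReal.ofReal (2 / 3) + ENNReal.ofReal (2 / 3)) := by
          rw [Finset.sum_const, Finset.card_univ, Fintype.card_fin, ← ENNReal.ofReal_add
            (by norm_num) (by norm_num), nsmul_eq_mul,
            show ((3 : ℕ) : ℝ≥0∞) = ENNReal.ofReal 3 by simp, ← ENNReal.ofReal_mul (by norm_num)]
          norm_num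
      _ ≤ ∑ i, volume (tip i 1 ∪ tip i (-1)) := Finset.sum_le_sum fun i _ => h1 i
  -- assemble
  have hsum : volume T + volume U ≤ ENNReal.ofReal 36 := by
    rw [← measure_union hdisj_TU hmU, ← hO36]
    exact measure_mono hsubO
  have h4 : volume T + ENNReal.ofReal 4 ≤ ENNReal.ofReal 36 :=
    (add_le_add le_rfl hU4).trans hsum
  calc volume T ≤ ENNReal.ofReal 36 - ENNReal.ofReal 4 :=
        ENNReal.le_sub_of_add_le_right ENNReal.ofReal_ne_top h4
    _ = ENNReal.ofReal 32 := by
        rw [← ENNReal.ofReal_sub _ (by norm_num : (0 : ℝ) ≤ 4)]; norm_num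

end VolumeEq

/-- **The truncated octahedron `{‖x‖_∞ ≤ 2} ∩ {‖x‖₁ ≤ 3}` has volume exactly `32`** (the printed
`|W_{ϕ_FCC}| = 2⁸` for the doubled body `{‖ζ‖_∞ ≤ 4} ∩ {‖ζ‖₁ ≤ 6}`, proof of Prop. 2.4, Step 3).
[cite: CicaleseKreutzLeonardi2023, Proposition 2.4 (25), proof Step 3] -/
theorem volume_truncOct :
    volume {x : EuclideanSpace ℝ (Fin 3) | (∀ i, |x i| ≤ 2) ∧ ∑ i, |x i| ≤ 3} = ENNReal.ofReal 32 := by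
  refine le_antisymm ?_ le_volume_truncOct
  have hm : MeasurableSet {x : EuclideanSpace ℝ (Fin 3) | (∀ i, |x i| ≤ 2) ∧ ∑ i, |x i| ≤ 3} := by
    rw [← fccWulffBody_eq_truncOct, fccWulffBody]
    exact ((Set.toFinite _).isCompact_convexHull ℝ).isClosed.measurableSet
  rw [← (PiLp.volume_preserving_toLp (Fin 3)).measure_preimage hm.nullMeasurableSet]
  exact volume_truncOct_pi_le

/-- **The fcc Wulff body `conv{perm(0, ±1, ±2)}` has volume exactly `32`** (`= 2⁸/2³`, the printed
`|W_{ϕ_FCC}| = 2⁸` in the halved normalisation). [cite: CicaleseKreutzLeonardi2023, Proposition 2.4 (25), proof Step 3] -/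
theorem volume_fccWulffBody : volume fccWulffBody = ENNReal.ofReal 32 := by
  rw [fccWulffBody_eq_truncOct, volume_truncOct]

/-- The printed Wulff set (22) of `φ_fcc` has volume `32`. [cite: CicaleseKreutzLeonardi2023, Proposition 2.4 (25), proof Step 3] -/
theorem volume_wulffSet_phiFcc : volume (wulffSet phiFcc) = ENNReal.ofReal 32 := by
  rw [wulffSet_phiFcc_eq_fccWulffBody, volume_fccWulffBody]

/-- The support body `{y | ∀ ν, ⟪y, ν⟫ ≤ φ_fcc(ν)}` (the venture's `wulffOf`-form) has volume `32`:
the `|W| = 32` of the single-crystal constant `3·|W|^{1/3} = 6·2^{2/3}`.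
[cite: CicaleseKreutzLeonardi2023, Proposition 2.4 (25), proof Step 3] -/
theorem volume_setOf_forall_inner_le_phiFcc :
    volume {y : EuclideanSpace ℝ (Fin 3) | ∀ ν : EuclideanSpace ℝ (Fin 3), ⟪y, ν⟫ ≤ phiFcc ν} =
      ENNReal.ofReal 32 := by
  rw [← fccWulffBody_eq_setOf_forall_inner, volume_fccWulffBody]

/-! ### The anisotropic perimeter of the fcc Wulff body itself: `P_W(W) = 96` -/

section SelfPerimeter

open Literature.Analysis.Convexity (anisotropicPerimeter anisotropicPerimeter_self)

/-- The fcc Wulff body `conv{perm(0, ±1, ±2)}` is compact.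
[cite: CicaleseKreutzLeonardi2023, Proposition 2.4 (24)] -/
theorem isCompact_fccWulffBody : IsCompact fccWulffBody := by
  unfold fccWulffBody
  exact (Set.toFinite _).isCompact_convexHull ℝ

/-- The fcc Wulff body is convex. [cite: CicaleseKreutzLeonardi2023, Proposition 2.4 (24)] -/
theorem convex_fccWulffBody : Convex ℝ fccWulffBody := by
  unfold fccWulffBody
  exact convex_convexHull ℝ _

/-- The fcc Wulff body contains the origin. [cite: CicaleseKreutzLeonardi2023, Proposition 2.4 (24)] -/
theorem zero_mem_fccWulffBody : (0 : EuclideanSpace ℝ (Fin 3)) ∈ fccWulffBody := by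
  rw [mem_fccWulffBody_iff]
  simp

/-- **`P_W(W) = 96` for the fcc Wulff body** (`W = conv{perm(0, ±1, ±2)}`, constraint body `W`
itself, i.e. integrand `h_W = φ_fcc`): `anisotropicPerimeter W W = 3 · |W| = 3 · 32`. The equality
case of the one-grain Wulff bound `Per_W(E) ≥ 3|W|^{1/3}|E|^{2/3}` at `E = W`.
[cite: Maggi2012, Proposition 20.10 (iii), eq. (20.11) p. 263; CicaleseKreutzLeonardi2023, Proposition 2.4 (25)] -/
theorem anisotropicPerimeter_fccWulffBody_self :
    anisotropicPerimeter fccWulffBody fccWulffBody = ENNReal.ofReal 96 := by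
  rw [anisotropicPerimeter_self (n := 3) (by norm_num) isCompact_fccWulffBody convex_fccWulffBody
    zero_mem_fccWulffBody, volume_fccWulffBody,
    show ((3 : ℕ) : ℝ≥0∞) = ENNReal.ofReal 3 by norm_num, ← ENNReal.ofReal_mul (by norm_num)]
  norm_num

/-- **`P_W(W) = 96`, real-valued form** (the venture's `Per K S := (anisotropicPerimeter K S).toReal`).
[cite: Maggi2012, Proposition 20.10 (iii), eq. (20.11) p. 263; CicaleseKreutzLeonardi2023, Proposition 2.4 (25)] -/
theorem toReal_anisotropicPerimeter_fccWulffBody_self :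
    (anisotropicPerimeter fccWulffBody fccWulffBody).toReal = 96 := by
  rw [anisotropicPerimeter_fccWulffBody_self, ENNReal.toReal_ofReal (by norm_num)]

/-- **`P_W(W) = 96` for the support-body spelling** `W = {y | ∀ ν, ⟪y, ν⟫ ≤ φ_fcc(ν)}` (the cubic-frame
`W_cubic` of the venture's crux `PolycrystalWulffBound`; its `W_A = (L ∘ A) '' W_cubic`).
[cite: Maggi2012, Proposition 20.10 (iii), eq. (20.11) p. 263; CicaleseKreutzLeonardi2023, Proposition 2.4 (25)] -/
theorem anisotropicPerimeter_setOf_forall_inner_le_phiFcc_self :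
    anisotropicPerimeter
        {y : EuclideanSpace ℝ (Fin 3) | ∀ ν : EuclideanSpace ℝ (Fin 3), ⟪y, ν⟫ ≤ phiFcc ν}
        {y : EuclideanSpace ℝ (Fin 3) | ∀ ν : EuclideanSpace ℝ (Fin 3), ⟪y, ν⟫ ≤ phiFcc ν} =
      ENNReal.ofReal 96 := by
  rw [← fccWulffBody_eq_setOf_forall_inner, anisotropicPerimeter_fccWulffBody_self]

/-- **`P_W(W) = 96` for the printed Wulff set** `wulffSet φ_fcc` (Cicalese–Kreutz–Leonardi's (22)).
[cite: Maggi2012, Proposition 20.10 (iii), eq. (20.11) p. 263; CicaleseKreutzLeonardi2023, Proposition 2.4 (22), (25)] -/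
theorem anisotropicPerimeter_wulffSet_phiFcc_self :
    anisotropicPerimeter (wulffSet phiFcc) (wulffSet phiFcc) = ENNReal.ofReal 96 := by
  rw [wulffSet_phiFcc_eq_fccWulffBody, anisotropicPerimeter_fccWulffBody_self]

end SelfPerimeter

end Literature.MathematicalPhysics.StatisticalMechanics

end
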